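import Summits.ResolutionOfSingularities.ResolutionOfSingularities.Theorems.PAlterationPalterationThesisStubQuotientInduction
import HarnessLib

/-!
# Crux `PalterationThesis` (stmt-ResolutionOfSingularities-0552), line `Sketch` rev. c2:
# the coatom induction for normalisations of regular varieties inside `K(W)^{1/p}`

Route `ResolutionOfSingularities/pAlteration`; helper file (`--supports stmt-0552`). The crux
idea card `Ideas/multiplicative-residue-tame-destack.md` states its residue `R1Perfect` as: for
`W` regular over a perfect field `K` and `L` a COATOM of the lattice `K(W) ⊆ · ⊆ K(W)^{1/p}`
(`[K(W)^{1/p} : L] = p`), the normalisation `W^L` has a resolution — "the quotient of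
`W^{1/p} ≅ W` by ONE `p`-closed vector field". In Frobenius-twisted coordinates (no `p`-th roots:
`K(W)^{1/p} ≅ K(W)` by `x ↦ x^p`, carrying `L` to `E = L^p`, a subfield `K(W)^p ⊆ E ⊆ K(W)` of
index `p`, and `W^L ≅ W^{(E, Frob)}`), this is the statement `R1D_K`:

  for `B` regular integral separated of finite type over `K`, a finite extension `E/K(B)` and a
  ring map `β : E → K(B)` with `β ∘ (K(B) → E) = Frobenius` and `[K(B) : β(E)] = p`, the
  normalisation `B^E` has a resolution

— exactly the conclusion shape of the landed twisted presentation `stub_core`, at index `p`.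
This file proves the induction step `claimD_succ` of: `R1D_K ⟹` the same statement at every
index `p^M` (`ClaimD_K M`), WITHOUT passing through quotient presentations `h : W → X`:
given `(B, E, β)` of index `p^(M+1)`, let `S := β(E)` and choose `S ⊆ E₁ ⊆ K(B)` with
`[K(B) : E₁] = p` (`stub_pTower`); `X := B^E` is normal with `K(X) ≅ E ≅ S`, and
`X₁ := X^{E₁}` (`E₁` over `K(X)` through `S ⊆ E₁`) is normal, finite over `B`, with
`B^{K(X₁)} ≅ X₁` (comparison) of index `[K(B) : E₁] = p`, so `R1D_K` resolves `X₁` by a regular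
`X̃₁`, `K(X̃₁) ≅ E₁`. The Frobenius twist `𝕂 := (K(X), Frob)` is a `K(X̃₁)`-algebra through
`E₁ → S ≅ K(X)`, `z ↦ z^p` (as `E₁^p ⊆ K(B)^p ⊆ S`), inside `K(X̃₁)^{1/p}` via
`β' : 𝕂 ≅ S ⊆ E₁ ≅ K(X̃₁)` of index `[E₁ : S] = p^M`; the induction hypothesis resolves `X̃₁^𝕂`,
the transport `hasResolution_normalizationIn_of_isProper` along `X̃₁ → X₁ → X` resolves
`X^𝕂 = X^{(K(X), Frob)}`, and the latter is `≅ X` (comparison for the finite Frobenius of `X`).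
-/

set_option linter.dupNamespace false

noncomputable section

open CategoryTheory AlgebraicGeometry TopologicalSpace
open Literature.AlgebraicGeometry.Resolution Literature.AlgebraicGeometry.Motives

namespace Summit.ResolutionOfSingularities.ResolutionOfSingularities.Theorems.PalterationThesis.PerfectQuotient

/-- **The induction step for `ClaimD`** (see the module docstring): over a perfect field `K` of
characteristic `p`, granted `R1D_K` (index `p`) and `ClaimD_K M` (index `p^M`), every
normalisation `B^E` of a regular `B` in an extension `E ⊆ K(B)^{1/p}` of `β`-index `p^(M+1)`
has a resolution. [folklore] -/
theorem claimD_succ (p : ℕ) (hp : p.Prime) (K : Type) [Field K] [CharP K p] [PerfectField K]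
    (M : ℕ)
    (hR1D : ∀ (B : Scheme.{0}) [IsIntegral B] (f : B ⟶ Spec (.of K)),
        IsSeparated f → LocallyOfFiniteType f → QuasiCompact f → Scheme.IsRegular B →
        ∀ (E : Type) [Field E] [Algebra B.functionField E] [FiniteDimensional B.functionField E]
          (β : E →+* B.functionField),
          (∀ b : B.functionField, β (algebraMap B.functionField E b) = b ^ p) →
          Module.finrank β.fieldRange B.functionField = p →
          Scheme.HasResolution (normalizationIn B E))
    (hIH : ∀ (B : Scheme.{0}) [IsIntegral B] (f : B ⟶ Spec (.of K)),
        IsSeparated f → LocallyOfFiniteType f → QuasiCompact f → Scheme.IsRegular B →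
        ∀ (E : Type) [Field E] [Algebra B.functionField E] [FiniteDimensional B.functionField E]
          (β : E →+* B.functionField),
          (∀ b : B.functionField, β (algebraMap B.functionField E b) = b ^ p) →
          Module.finrank β.fieldRange B.functionField = p ^ M →
          Scheme.HasResolution (normalizationIn B E))
    (B : Scheme.{0}) [IsIntegral B] (f : B ⟶ Spec (.of K)) [IsSeparated f]
    [LocallyOfFiniteType f] [QuasiCompact f] (hBreg : Scheme.IsRegular B)
    (E : Type) [Field E] [Algebra B.functionField E] [FiniteDimensional B.functionField E]
    (β : E →+* B.functionField) (hβ : ∀ b : B.functionField, β (algebraMap B.functionField E b) = b ^ p)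
    (hdeg : Module.finrank β.fieldRange B.functionField = p ^ (M + 1)) :
    Scheme.HasResolution (normalizationIn B E) := by
  haveI : Fact p.Prime := ⟨hp⟩
  haveI : CharP B.functionField p := Picover.TowerTransport.charP_functionField B f
  haveI : ExpChar B.functionField p := ExpChar.prime hp
  -- the subfield `S := β(E)`, `K(B)^p ⊆ S ⊆ K(B)`, `[K(B) : S] = p^(M+1)`
  set S : Subfield B.functionField := β.fieldRange with hSdef
  have hSp : ∀ b : B.functionField, b ^ p ∈ S := fun b => ⟨algebraMap B.functionField E b, hβ b⟩
  haveI : CharP S p := ((algebraMap S B.functionField).charP_iff_charP p).mpr inferInstance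
  haveI : ExpChar S p := ExpChar.prime hp
  haveI : FiniteDimensional S B.functionField :=
    Module.finite_of_finrank_pos (by rw [hdeg]; exact pow_pos hp.pos _)
  haveI : IsPurelyInseparable S B.functionField := by
    rw [isPurelyInseparable_iff_pow_mem S p]
    exact fun x => ⟨1, ⟨x ^ p, hSp x⟩, by rw [pow_one]; rfl⟩
  -- Step 1: `E₁`, `S ⊆ E₁ ⊆ K(B)`, `[K(B) : E₁] = p`, `[E₁ : S] = p^M`
  have hne : Module.finrank S B.functionField ≠ 1 := by
    rw [hdeg]
    exact (Nat.one_lt_pow (Nat.succ_ne_zero M) hp.one_lt).ne'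
  obtain ⟨E₁, hE₁⟩ := Picover.PTower.stub_pTower p S B.functionField hne
  have hME₁ : Module.finrank S E₁ = p ^ M := by
    have htower := Module.finrank_mul_finrank S E₁ B.functionField
    rw [hE₁, hdeg, pow_succ] at htower
    exact Nat.eq_of_mul_eq_mul_right hp.pos htower
  haveI : FiniteDimensional S E₁ := Module.finite_of_finrank_pos (by rw [hME₁]; exact pow_pos hp.pos _)
  -- Step 2: `X := B^E`, normal, finite over `B`, `K(X) ≅ E` over `K(B)`
  haveI : IsFinite (normalizationInι B E) := isFinite_normalizationInι B E f
  have hXn : ∀ x : normalizationIn B E,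
      IsIntegrallyClosed ((normalizationIn B E).presheaf.stalk x) :=
    isIntegrallyClosed_stalk_normalizationIn B E
  obtain ⟨eN, heN⟩ := Picover.FunctionFieldNormalizationIn.stub_functionField_normalizationIn B E
  have heN' : ∀ b : B.functionField, eN (RatFn.functionFieldMap (normalizationInι B E) b) =
      algebraMap B.functionField E b := fun b => by
    have h1 := RingHom.congr_fun heN b
    simpa using h1
  haveI : CharP (normalizationIn B E).functionField p :=
    Picover.TowerTransport.charP_functionField (normalizationIn B E) (normalizationInι B E ≫ f)
  haveI : ExpChar (normalizationIn B E).functionField p := ExpChar.prime hp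
  -- `E₁` as an extension of `K(X)` through `K(X) ≅ E ≅ S ⊆ E₁`
  let τ : (normalizationIn B E).functionField →+* E₁ :=
    (algebraMap S E₁).comp (β.rangeRestrictFieldEquiv.toRingHom.comp eN.toRingHom)
  have hτ : ∀ x, ((τ x : E₁) : B.functionField) = β (eN x) := fun x => rfl
  letI algτ : Algebra (normalizationIn B E).functionField E₁ := τ.toAlgebra
  have halgτ : ∀ x, algebraMap (normalizationIn B E).functionField E₁ x = τ x := fun _ => rfl
  have hfinτ : Module.finrank (normalizationIn B E).functionField E₁ = p ^ M := by
    rw [← hME₁]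
    refine Algebra.finrank_eq_of_equiv_equiv (eN.trans β.rangeRestrictFieldEquiv)
      (RingEquiv.refl E₁) ?_
    ext x
    rfl
  haveI : FiniteDimensional (normalizationIn B E).functionField E₁ :=
    Module.finite_of_finrank_pos (by rw [hfinτ]; exact pow_pos hp.pos _)
  haveI : IsPurelyInseparable (normalizationIn B E).functionField E₁ := by
    rw [isPurelyInseparable_iff_pow_mem _ p]
    intro z
    refine ⟨1, eN.symm (β.rangeRestrictFieldEquiv.symm ⟨(z : B.functionField) ^ p, hSp _⟩), ?_⟩
    apply Subtype.ext
    rw [halgτ, hτ, RingEquiv.apply_symm_apply, RingHom.rangeRestrictFieldEquiv_apply_symm_apply,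
      pow_one]
    rfl
  -- Step 3: `X₁ := X^{E₁}`, normal, finite radicial over `X`, `K(X₁) ≅ E₁` over `K(X)`
  haveI : IsFinite (normalizationInι (normalizationIn B E) E₁) :=
    isFinite_normalizationInι (normalizationIn B E) E₁ (normalizationInι B E ≫ f)
  haveI : UniversallyInjective (normalizationInι (normalizationIn B E) E₁) :=
    universallyInjective_normalizationInι_of_isPurelyInseparable (normalizationIn B E) E₁ p hXn
  have hX₁n : ∀ y : normalizationIn (normalizationIn B E) E₁,
      IsIntegrallyClosed ((normalizationIn (normalizationIn B E) E₁).presheaf.stalk y) :=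
    isIntegrallyClosed_stalk_normalizationIn (normalizationIn B E) E₁
  obtain ⟨e₁, he₁⟩ :=
    Picover.FunctionFieldNormalizationIn.stub_functionField_normalizationIn (normalizationIn B E) E₁
  have he₁' : ∀ x, e₁ (RatFn.functionFieldMap (normalizationInι (normalizationIn B E) E₁) x) =
      τ x := fun x => by
    have h1 := RingHom.congr_fun he₁ x
    simp only [RingEquiv.toRingHom_eq_coe, RingHom.coe_comp, RingHom.coe_coe,
      Function.comp_apply] at h1
    exact h1
  -- Step 4: `R1D` resolves `X₁`: `B^{K(X₁)} ≅ X₁` has index `[K(B) : E₁] = p`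
  set k : normalizationIn (normalizationIn B E) E₁ ⟶ B :=
    normalizationInι (normalizationIn B E) E₁ ≫ normalizationInι B E with hkdef
  haveI : IsFinite k := by rw [hkdef]; infer_instance
  haveI : IsDominant k := by rw [hkdef]; infer_instance
  let β₁ : FunctionFieldOver k →+* B.functionField :=
    (algebraMap E₁ B.functionField).comp (e₁.toRingHom.comp (FunctionFieldOver.of k).symm.toRingHom)
  have hβ₁ : ∀ b : B.functionField, β₁ (algebraMap B.functionField (FunctionFieldOver k) b) = b ^ p := by
    intro b
    have hk := Picover.OfNormalizationIn.functionFieldMap_eq_comp_of_eq (normalizationInι B E)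
      (normalizationInι (normalizationIn B E) E₁) k hkdef
    rw [FunctionFieldOver.algebraMap_apply, hk]
    change algebraMap E₁ B.functionField (e₁ (RatFn.functionFieldMap
      (normalizationInι (normalizationIn B E) E₁) (RatFn.functionFieldMap (normalizationInι B E) b))) = b ^ p
    rw [he₁']
    change ((τ _ : E₁) : B.functionField) = b ^ p
    rw [hτ, heN', hβ]
  have hdeg₁ : Module.finrank β₁.fieldRange B.functionField = p := by
    rw [finrank_fieldRange_eq, ← hE₁]
    letI : Algebra (FunctionFieldOver k) B.functionField := β₁.toAlgebra
    refine Algebra.finrank_eq_of_equiv_equiv ((FunctionFieldOver.of k).symm.trans e₁)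
      (RingEquiv.refl B.functionField) ?_
    ext x
    rfl
  have hresB₁ : Scheme.HasResolution (normalizationIn B (FunctionFieldOver k)) :=
    hR1D B f inferInstance inferInstance inferInstance hBreg (FunctionFieldOver k) β₁ hβ₁ hdeg₁
  obtain ⟨φ₁, hφ₁, -, -⟩ :=
    exists_isIso_comparison_of_normal K B (normalizationIn (normalizationIn B E) E₁) f k hX₁n
  haveI := hφ₁
  have hres₁ : Scheme.HasResolution (normalizationIn (normalizationIn B E) E₁) :=
    Scheme.HasResolution.of_iso φ₁ hresB₁
  -- Step 5: a resolution `ρ : X̃₁ → X₁`, `K(X̃₁) ≅ E₁`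
  obtain ⟨X₁', ρ, hρ⟩ := hres₁
  haveI : IsProper ρ := hρ.isProper
  haveI : IsReduced X₁' := hρ.isRegular.isReduced
  haveI : IsIntegral X₁' := hρ.isBirational.isIntegral
  haveI : IsDominant ρ := hρ.isBirational.isDominant
  have hbijρ : Function.Bijective (RatFn.functionFieldMap ρ) :=
    Picover.TowerTransport.bijective_functionFieldMap_of_isIso ρ
      hρ.isBirational.isIso_stalkMap_genericPoint
  let eρ : (normalizationIn (normalizationIn B E) E₁).functionField ≃+* X₁'.functionField :=
    RingEquiv.ofBijective _ hbijρ
  let θ : E₁ ≃+* X₁'.functionField := e₁.symm.trans eρ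
  -- Step 6: the finite Frobenius `F` of `X` and the twisted field `𝕂 = FunctionFieldOver F`
  have hpX : (p : Γ(normalizationIn B E, ⊤)) = 0 := natCast_appTop_eq_zero p (normalizationInι B E ≫ f)
  have haddX := add_pow_sections p hpX 1
  set F := powEndo (normalizationIn B E) (p ^ 1) (pow_ne_zero 1 hp.ne_zero) haddX with hFdef
  haveI : IsFinite F := isFinite_powEndo p (normalizationInι B E ≫ f) 1 haddX
  haveI : UniversallyInjective F := universallyInjective_powEndo (normalizationIn B E) p 1 haddX hpX
  haveI : Surjective F := ⟨fun x => ⟨x, rfl⟩⟩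
  have hF : ∀ y : (normalizationIn B E).functionField, RatFn.functionFieldMap F y = y ^ p ^ 1 :=
    functionFieldMap_powEndo (normalizationIn B E) (p ^ 1) _ haddX
  -- the `p`-th power map `E₁ → K(X)`: `z ↦ z^p ∈ K(B)^p ⊆ S ≅ K(X)`
  let frS : E₁ →+* S :=
    ((frobenius B.functionField p).comp (algebraMap E₁ B.functionField)).codRestrict S fun z => hSp _
  have hfrS : ∀ z : E₁, ((frS z : S) : B.functionField) = (z : B.functionField) ^ p := fun z => rfl
  let lam : E₁ →+* (normalizationIn B E).functionField :=
    eN.symm.toRingHom.comp (β.rangeRestrictFieldEquiv.symm.toRingHom.comp frS)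
  have hlam : ∀ z : E₁, τ (lam z) = z ^ p := by
    intro z
    apply Subtype.ext
    rw [hτ]
    change β (eN (eN.symm (β.rangeRestrictFieldEquiv.symm (frS z)))) = ((z ^ p : E₁) : B.functionField)
    rw [RingEquiv.apply_symm_apply, RingHom.rangeRestrictFieldEquiv_apply_symm_apply, hfrS]
    rfl
  have hlam' : ∀ x : (normalizationIn B E).functionField, lam (τ x) = x ^ p := by
    intro x
    apply eN.injective
    change eN (eN.symm (β.rangeRestrictFieldEquiv.symm (frS (τ x)))) = eN (x ^ p)
    rw [RingEquiv.apply_symm_apply, map_pow, RingEquiv.symm_apply_eq]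
    apply Subtype.ext
    rw [hfrS, hτ, RingHom.rangeRestrictFieldEquiv_apply_coe, map_pow]
  -- `𝕂` as a `K(X₁')`-algebra
  let μ : X₁'.functionField →+* FunctionFieldOver F :=
    (FunctionFieldOver.of F).toRingHom.comp (lam.comp θ.symm.toRingHom)
  letI algμ : Algebra X₁'.functionField (FunctionFieldOver F) := μ.toAlgebra
  have hμ : ∀ y : X₁'.functionField, algebraMap X₁'.functionField (FunctionFieldOver F) y =
      FunctionFieldOver.of F (lam (θ.symm y)) := fun _ => rfl
  clear_value frS lam
  have hcompat : (algebraMap X₁'.functionField (FunctionFieldOver F)).comp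
      (RatFn.functionFieldMap (ρ ≫ normalizationInι (normalizationIn B E) E₁)) =
        algebraMap (normalizationIn B E).functionField (FunctionFieldOver F) := by
    refine RingHom.ext fun x => ?_
    have h1 : θ.symm (RatFn.functionFieldMap (ρ ≫ normalizationInι (normalizationIn B E) E₁) x) =
          e₁ (RatFn.functionFieldMap (normalizationInι (normalizationIn B E) E₁) x) := by
      rw [RatFn.functionFieldMap_comp]
      change e₁ (eρ.symm (eρ (RatFn.functionFieldMap (normalizationInι (normalizationIn B E) E₁) x))) = _
      rw [RingEquiv.symm_apply_apply]
    rw [RingHom.comp_apply, hμ, h1, he₁', hlam', FunctionFieldOver.algebraMap_apply, hF, pow_one]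
  letI algXX₁' : Algebra (normalizationIn B E).functionField X₁'.functionField :=
    (RatFn.functionFieldMap (ρ ≫ normalizationInι (normalizationIn B E) E₁)).toAlgebra
  haveI : IsScalarTower (normalizationIn B E).functionField X₁'.functionField (FunctionFieldOver F) :=
    IsScalarTower.of_algebraMap_eq' hcompat.symm
  haveI : FiniteDimensional X₁'.functionField (FunctionFieldOver F) :=
    Module.Finite.of_restrictScalars_finite (normalizationIn B E).functionField X₁'.functionField
      (FunctionFieldOver F)
  -- `β' : 𝕂 → K(X₁')`, `K(X) ≅ S ⊆ E₁ ≅ K(X₁')`, of index `[E₁ : S] = p^M`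
  let β' : FunctionFieldOver F →+* X₁'.functionField :=
    θ.toRingHom.comp (τ.comp (FunctionFieldOver.of F).symm.toRingHom)
  have hβ' : ∀ y : X₁'.functionField,
      β' (algebraMap X₁'.functionField (FunctionFieldOver F) y) = y ^ p := by
    intro y
    rw [hμ]
    change θ (τ ((FunctionFieldOver.of F).symm (FunctionFieldOver.of F (lam (θ.symm y))))) = y ^ p
    rw [RingEquiv.symm_apply_apply, hlam, map_pow, RingEquiv.apply_symm_apply]
  have hbound : Module.finrank β'.fieldRange X₁'.functionField = p ^ M := by
    rw [finrank_fieldRange_eq, ← hME₁]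
    letI : Algebra (FunctionFieldOver F) X₁'.functionField := β'.toAlgebra
    refine Algebra.finrank_eq_of_equiv_equiv
      ((FunctionFieldOver.of F).symm.trans (eN.trans β.rangeRestrictFieldEquiv)) θ.symm ?_
    refine RingHom.ext fun x => ?_
    change algebraMap S E₁ (β.rangeRestrictFieldEquiv (eN ((FunctionFieldOver.of F).symm x))) =
      θ.symm (θ (τ ((FunctionFieldOver.of F).symm x)))
    rw [RingEquiv.symm_apply_apply]
    rfl
  -- Step 7: the induction hypothesis resolves `X₁'^𝕂`
  have hres' : Scheme.HasResolution (normalizationIn X₁' (FunctionFieldOver F)) :=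
    hIH X₁' ((ρ ≫ normalizationInι (normalizationIn B E) E₁) ≫ normalizationInι B E ≫ f)
      inferInstance inferInstance inferInstance hρ.isRegular (FunctionFieldOver F) β' hβ' hbound
  -- Step 8: transport to `X^𝕂` along the proper birational `X₁' → X₁ → X`
  have hfib : ∀ w' : X₁', (ρ ≫ normalizationInι (normalizationIn B E) E₁) w' =
      genericPoint (normalizationIn B E) → w' = genericPoint X₁' := by
    intro w' hw'
    rw [Scheme.Hom.comp_apply] at hw'
    have h1 : ρ w' = genericPoint (normalizationIn (normalizationIn B E) E₁) :=
      Picover.TowerTransport.eq_genericPoint_of_isIntegralHom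
        (normalizationInι (normalizationIn B E) E₁) hw'
    obtain ⟨U, hU, -, hUiso⟩ := hρ.isBirational
    haveI := hUiso
    have hηU : genericPoint (normalizationIn (normalizationIn B E) E₁) ∈ U :=
      ((genericPoint_spec (normalizationIn (normalizationIn B E) E₁)).mem_open_set_iff U.isOpen).mpr
        (by simpa using hU.nonempty)
    exact Picover.TowerTransport.subsingleton_preimage_of_isIso_morphismRestrict ρ U hηU h1
      (RatFn.genericPoint_eq_of_isDominant ρ)
  have hresX : Scheme.HasResolution (normalizationIn (normalizationIn B E) (FunctionFieldOver F)) :=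
    Picover.TowerTransport.hasResolution_normalizationIn_of_isProper
      Picover.FunctionFieldNormalizationIn.stub_functionField_normalizationIn (normalizationIn B E)
      (normalizationInι B E ≫ f) (FunctionFieldOver F) X₁'
      (ρ ≫ normalizationInι (normalizationIn B E) E₁) hcompat hfib hres'
  -- Step 9: `X^𝕂 = X^{K(X), Frob} ≅ X`
  obtain ⟨φX, hφX, -, -⟩ := exists_isIso_comparison_of_normal K (normalizationIn B E)
    (normalizationIn B E) (normalizationInι B E ≫ f) F hXn
  haveI := hφX
  exact Scheme.HasResolution.of_iso φX hresX

end Summit.ResolutionOfSingularities.ResolutionOfSingularities.Theorems.PalterationThesis.PerfectQuotient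

end
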